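import Literature.NumberTheory.DiophantineGeometry.AbcWave0GranvilleStarkEq11Proofs
import Literature.NumberTheory.LFunctions.BernoulliOneCharOddPrimitiveBound
import Summits.BirchSwinnertonDyer.BirchSwinnertonDyer.Theorems.EisensteinPrimesMazurMCOnCellBTwistbackPartnerTrivialZero
import HarnessLib

/-!
# The class number in Greenberg–Vatsal's unit criterion: `‖B₁^{(d)}(ω̃ ∘ ψ̄)‖_p = ‖h(−d)‖_p`
# (Dirichlet's class number formula for the odd quadratic character, read in `ℚ_p`; THEOREMS about
# the tree's definitions — curve-free, fact-free)

HONEST FRAMING (cell `bsd-eis`, width seat `bsd-line-x2-p1-w3` gen 7 on crux 3 `MazurMCOnCellB` =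
stmt-BirchSwinnertonDyer-19033, line `twistback` v4, LEAD `bsd-line-x2-p1` g10; programme D-0033).
Theorems only: no definition, no named fact, no `sorry`; nothing booked; no label / cell / stub / tier
moves; no summit statement, main conjecture or case of BSD is proved. CONTINUES the sibling file
`…TwistbackPartnerTrivialZero` (w3 gen 6, p643262), whose UNIT CRITERION
`order_toNat_eq_zero_of_isCharacterLFunctionD/C_of_units` reduces `λ(L_{Σ₀}(D, T)) = λ(L_{Σ₀}(C, T)) = 0`
for Greenberg–Vatsal's character `p`-adic `L`-functions (`IsCharacterLFunctionC/D`, GV §3 (26)/(27))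
to unit Euler factors and ONE character datum, `‖B₁^{(d)}(ω̃ ∘ ψ̄)‖ = 1`
(`B₁^{(d)}(θ) = twistedBernoulli p 1 d θ`, `ω̃ = teichmullerLift p`). That file left the datum
unidentified («`p ∤ h_F` by the class-number formula … NOT identified in this file»); the LEAD's road
(verdict g9 §4/§4′, HOME STATUS 2026-08-28 14:44Z; g10 «kernel F1» A2 «KL-flat certificate») calls
it «KL-flat». HERE, for the ODD QUADRATIC characters which occur at `p = 3` (every `𝔽₃ˣ`-valued
character is quadratic; on the 44 non-split A10 cells `ψ = χ_D`, HOME STATUS 14:46Z), the datum IS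
A CLASS NUMBER, inside the kernel and with NO named fact:

* §1 `norm_bernoulliOneChar_eq_classNumber`: for `χ` mod `d > 4` primitive, quadratic, odd,
  **`|B_{1,χ}| = h(−d)`**, `h(−d)` = the number of reduced primitive positive definite forms of
  discriminant `−d` (`BinaryQuadraticForm.classNumber`, Cox Thm. 2.13) — Dirichlet's class number
  formula `L(1, χ) = π h(−d)/√d` (tree `DiophantineGeometry.LFunction_one_eq`, Granville–Stark §3.2,
  PROVED in the tree from the Kronecker limit formula) times `|B_{1,χ}| = π⁻¹ √d |L(1, χ̄)|` (tree
  `BernoulliOneCharBound.norm_bernoulliOneChar_eq_sqrt_mul_norm_LFunction_one`, the functional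
  equation); `= h_K` for the imaginary quadratic field `K` with `d_K = −d` (tree
  `Quadratic.card_reducedForms_eq_classNumber`, Cox Thm. 7.7 (ii)) —
  `norm_bernoulliOneChar_eq_classNumber_field`.
* §2 `bernoulliOneChar_eq_ratCast` / `twistedBernoulli_one_eq_ratCast`: Lang's complex `B_{1,χ}`
  (`bernoulliOneChar`) and GV's `p`-adic `B₁^{(d)}(θ)` (`twistedBernoulli p 1 d θ`) are the images
  of the SAME rational number `Σ_{b<d} F(b)(b/d − ½)` as soon as `χ(b) = F(b)` in `ℂ` and
  `θ(b) = F(b)` in `ℤ_p` (`F : ℕ → ℤ` a common sign pattern — the idiom of the tree's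
  `PrimitiveQuadratic.norm_bernoulliOneChar_eq_natAbs_sum_div`); `ratCast_sum_eq_or_eq_neg`: that
  rational number is `± h(−d)`.
* §3 `teichmullerLift_inv_eq_intCast` / `teichmullerLift_eq_intCast`: for `p ≠ 2` and GV's
  `ψ : DirichletCharacter (ZMod p) d` with `ψ(b) = F(b) mod p`, `F(b) ∈ {0, ±1}`:
  `ω̃(ψ(b)⁻¹) = ω̃(ψ(b)) = F(b)` in `ℤ_p` (`ω̃(±1) = ±1`, `ω̃(0) = 0`).
* §4 **`norm_twistedBernoulli_teichmullerLift_inv_eq_norm_classNumber`**: `p ≠ 2`, `d > 4`, `χ`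
  mod `d` primitive quadratic odd, `ψ : DirichletCharacter (ZMod p) d` with the same sign pattern
  `F` ⟹ **`‖twistedBernoulli p 1 d (ω̃ ∘ ψ⁻¹)‖ = ‖(h(−d) : ℚ_p)‖`** (and the same without `⁻¹`,
  the `C`-side shape); hence `= 1 ↔ p ∤ h(−d)` (`…_eq_one_iff_not_dvd`), `< 1 ↔ p ∣ h(−d)`; field
  form `‖·‖ = ‖h_K‖` for any `K` with `[K : ℚ] = 2`, `d_K = −d` (`…_eq_norm_classNumber_field`).
* §5 compositions with the sibling certificates: `p ∤ h(−d)` ∧ `ψ(p) ≠ 1` ∧ unit Euler indicators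
  ⟹ `ord_T(L_{Σ₀}(D, T) mod p) = 0` (`order_toNat_eq_zero_of_isCharacterLFunctionD_of_not_dvd_classNumber`)
  and the `C`-twin (`…C_of_not_dvd_classNumber`).
The sequel `…TwistbackPartnerClassNumberLift` removes the complex character from the hypotheses
(every quadratic-valued `ψ : DirichletCharacter (ZMod p) d`, `p ≠ 2`, has a complex avatar with the
same sign pattern, conductor and parity).

USE (LEAD g9 verdict §4′, not asserted here): at an admissible partner `V = E ⊗ χ_K` of a non-split
A10 cell `(E, 3)` the odd character is `ψ_V = χ_{d·d_K}` and
`λ_an(V) = λ(L_{Σ₀}(C)) + λ(L_{Σ₀}(D)) − Σ δ_ℓ = 2·λ₃(ℚ(√(d·d_K))) + c(E)`; with this file the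
character-side input of the `{c(E) = 1}` road is literally `3 ∤ h(ℚ(√(d·d_K)))` — the shape of
Kriz–Li's output `h₃(d·d_K) = 1` (arXiv:1609.06687 §4) — and not a `p`-adic `L`-value.

References: [GreenbergVatsal2000] §3 pp. 41–42 ((26), (27)); [LangCyclotomic1990] Ch. 2 §1–§2
(`B_{1,χ}`, B 6–B 7), Ch. 1 §2 (`ω`); [Washington1997] Thm. 4.17 (the statement `B_{1,χ} = −2h/w` this
file proves for `w = 2` up to sign), Thm. 5.11; [GranvilleStark2000] §3.2 (`L(1, χ_{−d}) = πh(−d)/√d`);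
[Cox2013] Thm. 2.13, Thm. 7.7 (ii); [MontgomeryVaughan2007] Thm. 9.13.
-/

set_option autoImplicit false
set_option linter.dupNamespace false -- disclosed: the `…BirchSwinnertonDyer.BirchSwinnertonDyer…` namespace

noncomputable section

open scoped Classical

open Finset NumberField IsDedekindDomain DirichletCharacter
  Literature.NumberTheory.QuadraticFields
  Literature.NumberTheory.EllipticCurves
  Literature.NumberTheory.EllipticCurves.GreenbergVatsal2000
  Summit.BirchSwinnertonDyer.BirchSwinnertonDyer.Theorems.EisensteinPrimesMazurMCOnCellBTwistbackPartnerTrivialZero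
open Literature.NumberTheory.LFunctions (bernoulliOneChar bernoulliOneChar_def)

namespace Summit.BirchSwinnertonDyer.BirchSwinnertonDyer.Theorems.EisensteinPrimesMazurMCOnCellBTwistbackPartnerClassNumber

/-! ## §1. `|B_{1,χ}| = h(−d)` for the odd primitive quadratic character modulo `d > 4` -/

section Complex

variable {d : ℕ} [NeZero d]

/-- **Dirichlet's class number formula in `B₁`-form: `|B_{1,χ}| = h(−d)`** for `χ` mod `d > 4`
primitive, quadratic and odd, `h(−d)` the form class number of discriminant `−d` — from the tree's
`L(1, χ) = π h(−d)/√d` and `|B_{1,χ}| = π⁻¹ √d |L(1, χ̄)|` (`χ̄ = χ`). Washington Thm. 4.17 /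
Lang CNF⁻ for an imaginary quadratic field with `w = 2` reads `B_{1,χ} = −h`.
[cite: Washington1997, Thm. 4.17 (relative class number formula, imaginary quadratic case w = 2)]
[cite: GranvilleStark2000, §3.2 (L(1, χ_d) = π h(−d)/√d)] -/
theorem norm_bernoulliOneChar_eq_classNumber (hd : 4 < d) {χ : DirichletCharacter ℂ d}
    (hprim : χ.IsPrimitive) (hquad : χ.IsQuadratic) (hodd : χ.Odd) :
    ‖bernoulliOneChar χ‖ = (BinaryQuadraticForm.classNumber (-(d : ℤ)) : ℝ) := by
  have hd1 : d ≠ 1 := by omega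
  have hd0 : (0 : ℝ) < d := by exact_mod_cast (show 0 < d by omega)
  have hsd : 0 < Real.sqrt d := Real.sqrt_pos.2 hd0
  rw [Literature.NumberTheory.LFunctions.BernoulliOneCharBound.norm_bernoulliOneChar_eq_sqrt_mul_norm_LFunction_one
      hprim hodd hd1, hquad.inv, Literature.NumberTheory.DiophantineGeometry.LFunction_one_eq hd hprim hquad hodd,
    Complex.norm_real, Real.norm_eq_abs, abs_of_nonneg (by positivity)]
  field_simp

/-- **Field form: `|B_{1,χ}| = h_K`** for any imaginary quadratic field `K` with `d_K = −d < −4` and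
the odd primitive quadratic character `χ` mod `d` (`h(d_K) = h_K`, Cox Thm. 7.7 (ii), tree
`Quadratic.card_reducedForms_eq_classNumber`; such a `K` exists, tree
`Quadratic.exists_quadraticField_of_odd_primitive`). [cite: Cox2013, §7.B Thm. 7.7 (ii)]
[cite: Washington1997, Thm. 4.17] -/
theorem norm_bernoulliOneChar_eq_classNumber_field (hd : 4 < d) {χ : DirichletCharacter ℂ d}
    (hprim : χ.IsPrimitive) (hquad : χ.IsQuadratic) (hodd : χ.Odd)
    (K : Type*) [Field K] [NumberField K] (h2 : Module.finrank ℚ K = 2)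
    (hK : NumberField.discr K = -(d : ℤ)) :
    ‖bernoulliOneChar χ‖ = (NumberField.classNumber K : ℝ) := by
  rw [norm_bernoulliOneChar_eq_classNumber hd hprim hquad hodd,
    ← Quadratic.card_reducedForms_eq_classNumber h2 (by rw [hK]; omega), hK]

end Complex

/-! ## §2. One rational number with two faces: `B_{1,χ} ∈ ℂ` and `B₁^{(d)}(θ) ∈ ℚ_p` -/

section Rational

variable {d : ℕ}

/-- `B_{1,χ} = Σ_{b<d} F(b)(b/d − ½)` as a RATIONAL number, whenever `χ(b) = F(b) ∈ ℤ` for `b < d`.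
[cite: LangCyclotomic1990, Ch. 2 §1 (definition of B_{1,χ})] -/
theorem bernoulliOneChar_eq_ratCast (χ : DirichletCharacter ℂ d) {F : ℕ → ℤ}
    (hF : ∀ b, b < d → χ (b : ZMod d) = (F b : ℂ)) :
    bernoulliOneChar χ =
      ((∑ b ∈ Finset.range d, (F b : ℚ) * ((b : ℚ) / d - 1 / 2) : ℚ) : ℂ) := by
  rw [bernoulliOneChar_def]
  push_cast
  refine Finset.sum_congr rfl fun b hb ↦ ?_
  rw [hF b (Finset.mem_range.1 hb)]

/-- `B₁^{(d)}(θ) = twistedBernoulli p 1 d θ = Σ_{b<d} F(b)(b/d − ½)` as a RATIONAL number, whenever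
`θ(b) = F(b) ∈ ℤ` for `b < d` (`B₁(X) = X − ½`). [cite: LangCyclotomic1990, Ch. 2 §2 (B 6–B 7)] -/
theorem twistedBernoulli_one_eq_ratCast (p : ℕ) [Fact p.Prime] (θ : ℕ → ℤ_[p]) {F : ℕ → ℤ}
    (hθ : ∀ b, b < d → θ b = (F b : ℤ_[p])) :
    twistedBernoulli p 1 d θ =
      ((∑ b ∈ Finset.range d, (F b : ℚ) * ((b : ℚ) / d - 1 / 2) : ℚ) : ℚ_[p]) := by
  unfold twistedBernoulli
  simp only [Nat.sub_self, pow_zero, one_mul, Polynomial.bernoulli_one, Polynomial.eval_sub,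
    Polynomial.eval_X, Polynomial.eval_C]
  push_cast
  refine Finset.sum_congr rfl fun b hb ↦ ?_
  rw [hθ b (Finset.mem_range.1 hb)]
  push_cast
  ring

/-- A complex number of the form `(q : ℂ)`, `q ∈ ℚ`, with `‖(q : ℂ)‖ = n ∈ ℕ` has `q = n` or
`q = −n`. [folklore] -/
theorem ratCast_eq_or_eq_neg {q : ℚ} {n : ℕ} (h : ‖(q : ℂ)‖ = (n : ℝ)) :
    q = n ∨ q = -(n : ℚ) := by
  rw [Complex.norm_ratCast] at h
  rcases abs_eq (Nat.cast_nonneg n) |>.mp h with h1 | h1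
  · left; exact_mod_cast h1
  · right; exact_mod_cast h1

variable [NeZero d]

/-- **The rational number `Σ_{b<d} F(b)(b/d − ½)` is `± h(−d)`** when `F` is the sign pattern of
the odd primitive quadratic character mod `d > 4` (§1 and `bernoulliOneChar_eq_ratCast`).
[cite: Washington1997, Thm. 4.17] [cite: GranvilleStark2000, §3.2] -/
theorem sum_eq_classNumber_or_eq_neg (hd : 4 < d) {χ : DirichletCharacter ℂ d}
    (hprim : χ.IsPrimitive) (hquad : χ.IsQuadratic) (hodd : χ.Odd) {F : ℕ → ℤ}
    (hF : ∀ b, b < d → χ (b : ZMod d) = (F b : ℂ)) :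
    (∑ b ∈ Finset.range d, (F b : ℚ) * ((b : ℚ) / d - 1 / 2)) =
        (BinaryQuadraticForm.classNumber (-(d : ℤ)) : ℚ) ∨
      (∑ b ∈ Finset.range d, (F b : ℚ) * ((b : ℚ) / d - 1 / 2)) =
        -(BinaryQuadraticForm.classNumber (-(d : ℤ)) : ℚ) := by
  apply ratCast_eq_or_eq_neg
  rw [← bernoulliOneChar_eq_ratCast χ hF]
  exact norm_bernoulliOneChar_eq_classNumber hd hprim hquad hodd

omit [NeZero d] in
/-- The sign pattern `F` of a quadratic character takes values in `{0, 1, −1}` (on `b < d`).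
[folklore] -/
theorem intCast_trichotomy_of_isQuadratic {χ : DirichletCharacter ℂ d} (hquad : χ.IsQuadratic)
    {F : ℕ → ℤ} (hF : ∀ b, b < d → χ (b : ZMod d) = (F b : ℂ)) (b : ℕ) (hb : b < d) :
    F b = 0 ∨ F b = 1 ∨ F b = -1 := by
  rcases hquad (b : ZMod d) with h | h | h <;> rw [hF b hb] at h
  · left; exact_mod_cast h
  · right; left; exact_mod_cast h
  · right; right; exact_mod_cast h

end Rational

/-! ## §3. `ω̃(ψ(b)⁻¹) = ω̃(ψ(b)) = F(b)` in `ℤ_p` for a sign pattern `F` (`p ≠ 2`) -/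

section Teichmuller

variable (p : ℕ) [Fact p.Prime] {d : ℕ}

/-- For `p ≠ 2` and `s ∈ {0, 1, −1}`: `ω̃((s mod p)⁻¹) = s` in `ℤ_p` (`ω̃(0) = 0`, `ω̃(±1) = ±1`,
`(±1)⁻¹ = ±1`). [cite: LangCyclotomic1990, Ch. 1 §2 (the Teichmüller character) and Ch. 2 §2 (extension by 0)] -/
theorem teichmullerLift_inv_intCast (hp : p ≠ 2) {s : ℤ} (hs : s = 0 ∨ s = 1 ∨ s = -1) :
    teichmullerLift p ((s : ZMod p))⁻¹ = (s : ℤ_[p]) := by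
  rcases hs with rfl | rfl | rfl
  · rw [Int.cast_zero, inv_zero, teichmullerLift_zero, Int.cast_zero]
  · rw [Int.cast_one, inv_one, teichmullerLift_one, Int.cast_one]
  · rw [Int.cast_neg, Int.cast_one, inv_neg_one, teichmullerLift_neg_one p hp, Int.cast_neg,
      Int.cast_one]

/-- For `p ≠ 2` and `s ∈ {0, 1, −1}`: `ω̃(s mod p) = s` in `ℤ_p`.
[cite: LangCyclotomic1990, Ch. 1 §2 (the Teichmüller character) and Ch. 2 §2 (extension by 0)] -/
theorem teichmullerLift_intCast (hp : p ≠ 2) {s : ℤ} (hs : s = 0 ∨ s = 1 ∨ s = -1) :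
    teichmullerLift p (s : ZMod p) = (s : ℤ_[p]) := by
  rcases hs with rfl | rfl | rfl
  · rw [Int.cast_zero, teichmullerLift_zero, Int.cast_zero]
  · rw [Int.cast_one, teichmullerLift_one, Int.cast_one]
  · rw [Int.cast_neg, Int.cast_one, teichmullerLift_neg_one p hp, Int.cast_neg, Int.cast_one]

/-- **`ω̃ ∘ ψ⁻¹ = F` on `b < d`** for GV's `ψ : DirichletCharacter (ZMod p) d` with sign pattern `F`
(`ψ(b) = F(b) mod p`, `F(b) ∈ {0, ±1}`, `p ≠ 2`). [cite: GreenbergVatsal2000, §2 p. 28 (ψ with values in ℤ_pˣ via Teichmüller)] -/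
theorem teichmullerLift_inv_eq_intCast (hp : p ≠ 2) (ψ : DirichletCharacter (ZMod p) d)
    {F : ℕ → ℤ} (hFv : ∀ b, b < d → F b = 0 ∨ F b = 1 ∨ F b = -1)
    (hψF : ∀ b, b < d → ψ (b : ZMod d) = ((F b : ℤ) : ZMod p)) (b : ℕ) (hb : b < d) :
    teichmullerLift p (ψ (b : ZMod d))⁻¹ = (F b : ℤ_[p]) := by
  rw [hψF b hb]
  exact teichmullerLift_inv_intCast p hp (hFv b hb)

/-- **`ω̃ ∘ ψ = F` on `b < d`** (the `C`-side shape, no inverse) under the same hypotheses.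
[cite: GreenbergVatsal2000, §2 p. 28 (φ, ψ with values in ℤ_pˣ via Teichmüller)] -/
theorem teichmullerLift_eq_intCast (hp : p ≠ 2) (ψ : DirichletCharacter (ZMod p) d)
    {F : ℕ → ℤ} (hFv : ∀ b, b < d → F b = 0 ∨ F b = 1 ∨ F b = -1)
    (hψF : ∀ b, b < d → ψ (b : ZMod d) = ((F b : ℤ) : ZMod p)) (b : ℕ) (hb : b < d) :
    teichmullerLift p (ψ (b : ZMod d)) = (F b : ℤ_[p]) := by
  rw [hψF b hb]
  exact teichmullerLift_intCast p hp (hFv b hb)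

end Teichmuller

/-! ## §4. `‖B₁^{(d)}(ω̃ ∘ ψ̄)‖_p = ‖h(−d)‖_p` -/

section Main

variable (p : ℕ) [Fact p.Prime] {d : ℕ} [NeZero d]

/-- The `p`-adic norm of `(±n : ℚ_p)` for the rational number `q = ±n`. [folklore] -/
theorem norm_ratCast_eq_of_eq_or_eq_neg {q : ℚ} {n : ℕ} (h : q = n ∨ q = -(n : ℚ)) :
    ‖((q : ℚ) : ℚ_[p])‖ = ‖((n : ℕ) : ℚ_[p])‖ := by
  rcases h with rfl | rfl
  · push_cast; rfl
  · push_cast; rw [norm_neg]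

/-- **`‖B₁^{(d)}(ω̃ ∘ ψ⁻¹)‖_p = ‖h(−d)‖_p`.** For `p ≠ 2`, `d > 4`, `χ` mod `d` primitive quadratic
odd with sign pattern `F` (`χ(b) = F(b)`), and GV's `ψ : DirichletCharacter (ZMod p) d` with the
same sign pattern (`ψ(b) = F(b) mod p`): the `p`-adic norm of GV's
`twistedBernoulli p 1 d (ω̃ ∘ ψ⁻¹)` — the character datum of the sibling unit criterion for
`L_{Σ₀}(D, T)` — is `‖h(−d)‖_p`, `h(−d)` the form class number of discriminant `−d`.
[cite: Washington1997, Thm. 4.17 (B_{1,χ} = −2h/w)] [cite: GreenbergVatsal2000, §3 p. 42 (27)] -/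
theorem norm_twistedBernoulli_teichmullerLift_inv_eq_norm_classNumber (hp : p ≠ 2) (hd : 4 < d)
    {χ : DirichletCharacter ℂ d} (hprim : χ.IsPrimitive) (hquad : χ.IsQuadratic) (hodd : χ.Odd)
    (ψ : DirichletCharacter (ZMod p) d) {F : ℕ → ℤ}
    (hχF : ∀ b, b < d → χ (b : ZMod d) = (F b : ℂ))
    (hψF : ∀ b, b < d → ψ (b : ZMod d) = ((F b : ℤ) : ZMod p)) :
    ‖twistedBernoulli p 1 d (fun b : ℕ ↦ teichmullerLift p (ψ (b : ZMod d))⁻¹)‖ =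
      ‖((BinaryQuadraticForm.classNumber (-(d : ℤ)) : ℕ) : ℚ_[p])‖ := by
  rw [twistedBernoulli_one_eq_ratCast p _
      (teichmullerLift_inv_eq_intCast p hp ψ (intCast_trichotomy_of_isQuadratic hquad hχF) hψF)]
  exact norm_ratCast_eq_of_eq_or_eq_neg p (sum_eq_classNumber_or_eq_neg hd hprim hquad hodd hχF)

/-- **`‖B₁^{(d)}(ω̃ ∘ ψ)‖_p = ‖h(−d)‖_p`** — the `C`-side shape (no inverse; for a quadratic `ψ` the
two functions agree anyway), same hypotheses.
[cite: Washington1997, Thm. 4.17 (B_{1,χ} = −2h/w)] [cite: GreenbergVatsal2000, §3 p. 41 (26)] -/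
theorem norm_twistedBernoulli_teichmullerLift_eq_norm_classNumber (hp : p ≠ 2) (hd : 4 < d)
    {χ : DirichletCharacter ℂ d} (hprim : χ.IsPrimitive) (hquad : χ.IsQuadratic) (hodd : χ.Odd)
    (ψ : DirichletCharacter (ZMod p) d) {F : ℕ → ℤ}
    (hχF : ∀ b, b < d → χ (b : ZMod d) = (F b : ℂ))
    (hψF : ∀ b, b < d → ψ (b : ZMod d) = ((F b : ℤ) : ZMod p)) :
    ‖twistedBernoulli p 1 d (fun b : ℕ ↦ teichmullerLift p (ψ (b : ZMod d)))‖ =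
      ‖((BinaryQuadraticForm.classNumber (-(d : ℤ)) : ℕ) : ℚ_[p])‖ := by
  rw [twistedBernoulli_one_eq_ratCast p _
      (teichmullerLift_eq_intCast p hp ψ (intCast_trichotomy_of_isQuadratic hquad hχF) hψF)]
  exact norm_ratCast_eq_of_eq_or_eq_neg p (sum_eq_classNumber_or_eq_neg hd hprim hquad hodd hχF)

/-- **`‖B₁^{(d)}(ω̃ ∘ ψ⁻¹)‖_p = 1 ↔ p ∤ h(−d)`** (the unit condition of the sibling criterion as a
class-number condition). [cite: Washington1997, Thm. 4.17] -/
theorem norm_twistedBernoulli_teichmullerLift_inv_eq_one_iff (hp : p ≠ 2) (hd : 4 < d)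
    {χ : DirichletCharacter ℂ d} (hprim : χ.IsPrimitive) (hquad : χ.IsQuadratic) (hodd : χ.Odd)
    (ψ : DirichletCharacter (ZMod p) d) {F : ℕ → ℤ}
    (hχF : ∀ b, b < d → χ (b : ZMod d) = (F b : ℂ))
    (hψF : ∀ b, b < d → ψ (b : ZMod d) = ((F b : ℤ) : ZMod p)) :
    ‖twistedBernoulli p 1 d (fun b : ℕ ↦ teichmullerLift p (ψ (b : ZMod d))⁻¹)‖ = 1 ↔
      ¬ p ∣ BinaryQuadraticForm.classNumber (-(d : ℤ)) := by
  rw [norm_twistedBernoulli_teichmullerLift_inv_eq_norm_classNumber p hp hd hprim hquad hodd ψ hχF hψF,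
    Padic.norm_natCast_eq_one_iff, Nat.Prime.coprime_iff_not_dvd Fact.out]

/-- **`‖B₁^{(d)}(ω̃ ∘ ψ⁻¹)‖_p < 1 ↔ p ∣ h(−d)`** (`p` «irregular for `χ`» iff `p` divides the class
number). [cite: Washington1997, Thm. 4.17] -/
theorem norm_twistedBernoulli_teichmullerLift_inv_lt_one_iff (hp : p ≠ 2) (hd : 4 < d)
    {χ : DirichletCharacter ℂ d} (hprim : χ.IsPrimitive) (hquad : χ.IsQuadratic) (hodd : χ.Odd)
    (ψ : DirichletCharacter (ZMod p) d) {F : ℕ → ℤ}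
    (hχF : ∀ b, b < d → χ (b : ZMod d) = (F b : ℂ))
    (hψF : ∀ b, b < d → ψ (b : ZMod d) = ((F b : ℤ) : ZMod p)) :
    ‖twistedBernoulli p 1 d (fun b : ℕ ↦ teichmullerLift p (ψ (b : ZMod d))⁻¹)‖ < 1 ↔
      p ∣ BinaryQuadraticForm.classNumber (-(d : ℤ)) := by
  rw [norm_twistedBernoulli_teichmullerLift_inv_eq_norm_classNumber p hp hd hprim hquad hodd ψ hχF hψF,
    Padic.norm_natCast_lt_one_iff]

/-- **Field form: `‖B₁^{(d)}(ω̃ ∘ ψ⁻¹)‖_p = ‖h_K‖_p`** for any imaginary quadratic field `K` with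
`d_K = −d` (`[K : ℚ] = 2`), same hypotheses — so `p ∤ h_K ⇒` the unit condition.
[cite: Washington1997, Thm. 4.17] [cite: Cox2013, §7.B Thm. 7.7 (ii)] -/
theorem norm_twistedBernoulli_teichmullerLift_inv_eq_norm_classNumber_field (hp : p ≠ 2)
    (hd : 4 < d) {χ : DirichletCharacter ℂ d} (hprim : χ.IsPrimitive) (hquad : χ.IsQuadratic)
    (hodd : χ.Odd) (ψ : DirichletCharacter (ZMod p) d) {F : ℕ → ℤ}
    (hχF : ∀ b, b < d → χ (b : ZMod d) = (F b : ℂ))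
    (hψF : ∀ b, b < d → ψ (b : ZMod d) = ((F b : ℤ) : ZMod p))
    (K : Type*) [Field K] [NumberField K] (h2 : Module.finrank ℚ K = 2)
    (hK : NumberField.discr K = -(d : ℤ)) :
    ‖twistedBernoulli p 1 d (fun b : ℕ ↦ teichmullerLift p (ψ (b : ZMod d))⁻¹)‖ =
      ‖((NumberField.classNumber K : ℕ) : ℚ_[p])‖ := by
  rw [norm_twistedBernoulli_teichmullerLift_inv_eq_norm_classNumber p hp hd hprim hquad hodd ψ hχF hψF,
    ← Quadratic.card_reducedForms_eq_classNumber h2 (by rw [hK]; omega), hK]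

end Main

/-! ## §5. `p ∤ h(−d)` ⇒ `λ(L_{Σ₀}(D, T)) = λ(L_{Σ₀}(C, T)) = 0` (composition with the sibling file) -/

section Lambda

variable (p : ℕ) [Fact p.Prime] {d : ℕ} [NeZero d] (S₀ : Finset (HeightOneSpectrum (𝓞 ℚ)))

/-- **`λ(L_{Σ₀}(D, T)) = 0` from a class number.** For GV's odd character `ψ` mod `d > 4`
(`𝔽_p`-valued, `p ≠ 2`) whose sign pattern `F` is that of the odd primitive quadratic complex
character `χ` mod `d`: if `ψ(p) ≠ 1` (no trivial zero), every `ℓ_v` (`v ∈ Σ₀`) is `≠ p` with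
`ψ(ℓ_v) ≢ ℓ_v (mod p)`, and **`p ∤ h(−d)`**, then every `g ∈ Λ` interpolating GV (27) has
`ord_T(g mod p) = 0`. [cite: GreenbergVatsal2000, §3 p. 42 (27)] [cite: Washington1997, Thm. 4.17]
[cite: Greenberg2001PastPresent, §4 pp. 355–356] -/
theorem order_toNat_eq_zero_of_isCharacterLFunctionD_of_not_dvd_classNumber (hp : p ≠ 2)
    (hd : 4 < d) {χ : DirichletCharacter ℂ d} (hprim : χ.IsPrimitive) (hquad : χ.IsQuadratic)
    (hodd : χ.Odd) (ψ : DirichletCharacter (ZMod p) d) {F : ℕ → ℤ}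
    (hχF : ∀ b, b < d → χ (b : ZMod d) = (F b : ℂ))
    (hψF : ∀ b, b < d → ψ (b : ZMod d) = ((F b : ℤ) : ZMod p))
    {g : IwasawaAlgebra p} (hg : IsCharacterLFunctionD p ψ S₀ g) (hψp : ψ (p : ZMod d) ≠ 1)
    (hS : ∀ v ∈ S₀, Rat.HeightOneSpectrum.natGenerator v ≠ p ∧
      ψ (Rat.HeightOneSpectrum.natGenerator v : ZMod d) ≠
        ((Rat.HeightOneSpectrum.natGenerator v : ℕ) : ZMod p))
    (hh : ¬ p ∣ BinaryQuadraticForm.classNumber (-(d : ℤ))) :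
    (PowerSeries.map (PadicInt.toZMod (p := p)) g).order.toNat = 0 :=
  order_toNat_eq_zero_of_isCharacterLFunctionD_of_units p ψ S₀ hg hp hψp hS
    ((norm_twistedBernoulli_teichmullerLift_inv_eq_one_iff p hp hd hprim hquad hodd ψ hχF hψF).2 hh)

/-- **`λ(L_{Σ₀}(C, T)) = 0` from a class number** — the `C`-twin: for GV's even `φ` mod `m` with
`φ(a)·a⁻¹ = ψ'(a)` off `pℕ` (`ψ' = ψ⁻¹ = ψ` for quadratic `ψ`), `ψ'` mod `d > 4` with the sign
pattern of the odd primitive quadratic `χ`, `ψ'(p) ≠ 1`, `ψ'(ℓ_v) ≠ 1` at every `ℓ_v ≠ p`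
(`v ∈ Σ₀`), and **`p ∤ h(−d)`** ⟹ `ord_T(g mod p) = 0` for every `g` interpolating GV (26).
[cite: GreenbergVatsal2000, §3 p. 41 (26)] [cite: Washington1997, Thm. 4.17]
[cite: Greenberg2001PastPresent, §4 pp. 355–356] -/
theorem order_toNat_eq_zero_of_isCharacterLFunctionC_of_not_dvd_classNumber (hp : p ≠ 2)
    (hd : 4 < d) {χ : DirichletCharacter ℂ d} (hprim : χ.IsPrimitive) (hquad : χ.IsQuadratic)
    (hodd : χ.Odd) (ψ' : DirichletCharacter (ZMod p) d) {F : ℕ → ℤ}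
    (hχF : ∀ b, b < d → χ (b : ZMod d) = (F b : ℂ))
    (hψF : ∀ b, b < d → ψ' (b : ZMod d) = ((F b : ℤ) : ZMod p))
    {m : ℕ} (φ : DirichletCharacter (ZMod p) m) (hm : 0 < m)
    (hφψ : ∀ a : ℕ, ¬ p ∣ a → φ (a : ZMod m) * (a : ZMod p)⁻¹ = ψ' (a : ZMod d))
    {g : IwasawaAlgebra p} (hg : IsCharacterLFunctionC p φ S₀ g) (hψp : ψ' (p : ZMod d) ≠ 1)
    (hS : ∀ v ∈ S₀, Rat.HeightOneSpectrum.natGenerator v ≠ p ∧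
      ψ' (Rat.HeightOneSpectrum.natGenerator v : ZMod d) ≠ 1)
    (hh : ¬ p ∣ BinaryQuadraticForm.classNumber (-(d : ℤ))) :
    (PowerSeries.map (PadicInt.toZMod (p := p)) g).order.toNat = 0 := by
  refine order_toNat_eq_zero_of_isCharacterLFunctionC_of_units p φ S₀ ψ' hg hm hφψ hψp hS ?_
  rw [norm_twistedBernoulli_teichmullerLift_eq_norm_classNumber p hp hd hprim hquad hodd ψ' hχF hψF,
    Padic.norm_natCast_eq_one_iff]
  exact (Nat.Prime.coprime_iff_not_dvd Fact.out).2 hh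

end Lambda

end Summit.BirchSwinnertonDyer.BirchSwinnertonDyer.Theorems.EisensteinPrimesMazurMCOnCellBTwistbackPartnerClassNumber

end
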